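import Literature.MathematicalPhysics.QuantumFieldTheory.Balaban1983to89.B9LeafXCodedKnitUPar
import Literature.MathematicalPhysics.QuantumFieldTheory.Balaban1983to89.Node00.CarriersYUParH

/-!
# `Balaban1983to89.B9LeafXCodedKnitUParH` — CASCADE-K PIECE (director-ym №383), LEAF EDITION 2: THE [B9] LEAF OVER THE CODED CARRIER WITH THE TWO SITE
# TRANSPORTERS SEPARATED — AVERAGING `parA` (inside `G′ = GpY parA`, `C = CY parA …`, the analyticity family) AND HÖLDER `parH` (the (3.43) ∕ (3.45) readings
# `kernelFamilyS … (GpY parA) parH`) — AND THE BOND-AVERAGE LETTER `OA` (the re-press ONCE of `b9LeafX_carriersYUPar` over node00-def-Y's `Node00.carriersYUParH`)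

T. Bałaban, *Propagators for lattice gauge theories in a background field*, Commun. Math. Phys. **99** (1985) 389–434 [`Balaban1985BackgroundPropagators`, "B9"],
Sect. 3: Thms 3.1–3.4 and Cors 3.5–3.6 pp. 397–408, Thms 3.7–3.15 pp. 409–432, the class (3.35)–(3.38) p. 396, the site transporter (3.19) p. 393, the contours
(3.21) p. 394 (averaging) and (3.40) p. 397 (Hölder norms); T. Bałaban, *Averaging operations for lattice gauge theories*, Commun. Math. Phys. **98** (1985) 17–51
[`Balaban1985Averaging`], Prop. 2 p. 26 (print's knit transporter); [4] = `Balaban1984PropagatorsII`, Props. 2.2, 2.3, 2.6 (the case `U = 1`).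

statement-level bookkeeping over published theorems with citation tags; proofs where landed; nothing here is a claim about the Yang–Mills mass gap

WHY THIS FILE (cell context).  Edition 1 `B9LeafXCodedKnitUPar.b9LeafX_carriersYUPar` leafs `carriersYUParH P G f b ιB C38 parA parH OA ops`, whose G′-carrier is
dag-n06-c's `KSCU … (par j)` = `kernelFamilySU … (GpY par) par`: ONE transporter in both roles.  At the knit operator layer of record
(`Node00.OpsYRecordV11H.opsYNuStOfRecordV11KHE`, node00-def-Y g32; dag-n06-c FLAG K1-PAR) the two roles SEPARATE: the averaging transporter inside
`Δ′_a ∕ G′ ∕ Q′ ∕ C` is print's knit `parKnitY` while the Hölder readings (3.43) ∕ (3.45) of the letters are transported along print's (3.40) shortest contours,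
the record's `parSymY` — the leaf pin of record is `kernelFamilyS … (GpY parKnitY) parSymY` (`Node00.opsYNuStOfRecordV11KHE_GpPin`).  node00-def-Y's K0
`Node00.CarriersYUParH.carriersYUParH P G f b ιB C38 parA parH OA ops` carries both (`G′ := KSCUPar … (parA j) (parH j)`, dag-n06-c's `B9SectBCodedReadingsUParH`,
`C⁻¹ := CinvY … parA`, analyticity `IsAnKY … (parA j)`; edition 1 is its diagonal `parA = parH`, `rfl`); THIS FILE is the leaf lemma over it.

WHAT IS IN THE FILE (0 `def`, 0 `sorry`; standard axioms).
* §1 (the U-letter coded reading with two transporters at a base, `rfl`-level over dag-n06-c's `KSCUPar`): `KSCUPar_members_base` (the six members of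
  `KSCUPar … parA parH` at `base U` ARE those of `kernelFamilyS … (GpY parA) parH` read along the decoding, `rfl` ×6), `thms_KSCUPar_base_iff` (the Thm 3.1–3.3
  block at a base transports both ways), `thm31Printed_codedUPar`, `baseU1Printed_codedUPar`, `thm33Printed_codedUPar` (Thm 3.1 ∕ the `U ≡ 1` block ∕ Thm 3.3
  of the record read by `kernelFamilyS … (GpY parA) parH` (and `kernelFamilyB … OA parB`, `C⁻¹`) give the same over the coded carriers for
  `(KSCUPar parA parH, KACU, C⁻¹ ∘ dec)`) — the proofs of edition 1's `thm31Printed_codedU ∕ baseU1Printed_codedU` and dag-n06-c's `thm33Printed_codedU`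
  verbatim with the two transporters.
* §2 ★★★ `b9LeafX_carriersYUParH` — `B9LeafX (carriersYUParH P G f b ιB C38 parA parH OA ops)` from exactly the inputs of `b9LeafX_carriersYUPar` with the three
  pins and the coded Sect.-B step read at `(parA, parH, OA)`: `hGpPin : … (ops (f j)).Gp = kernelFamilyS … (GpY _ (parA j)) (parH j)`,
  `hGAPin : … (ops (f j)).GA = kernelFamilyB … (OA j) (parBY _)`, `hCinvPin : … (ops (f j)).Cinv = CinvY P f G parA j`,
  `hB : Thm32Printed … (CinvY P f G parA) → Thm33Printed … (kernelFamilyS … (GpY _ (parA j)) (parH j)) (kernelFamilyB … (OA j) (parBY _)) →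
  SectBStepUPar P f (d+1) c35Y G b parA parH OA (fun j => parBY _) … (CinvY P f G parA)` (dag-n06-c's K1 target shape `SectBStepUPar`).  At `parA = parH = par`
  it IS `b9LeafX_carriersYUPar` (same term, `carriersYUPar_eq_carriersYUParH` `rfl`); at `parA := fun j => parKnitY _`, `parH := fun j => parSymY _`,
  `OA := fun j => GAQY _ (qKnitOfRecord …) (qsKnitOfRecord …) (parKnitY _) (GpY _ (parKnitY _))` it leafs the knit certificate (K3) through def-Y's pins
  `opsYNuStOfRecordV11KHE_GpPin ∕ _GAPin ∕ _CinvPin`.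

HONEST SCOPE.  Composition of landed theorems and quantifier bookkeeping; nothing of [B9] is asserted or proved here beyond what the inputs say; the coded step, the
pins, the rows and the [B6] block stay DISPLAYED hypotheses.  COUNT-NEUTRAL; N06 NOT discharged; one finite lattice programme at fixed `ε` — nothing continuum ∕ OS ∕
mass-gap ∕ Clay.  Cell `pub-ymgap` (HUMAN RULING D-0062), Track A node N06 [B9], seat `pub-ymgap-dag-n06-d` (g25), 2026-08-30.

RELATED IN THE TREE, NOT DUPLICATED: `B9LeafXCodedKnitUPar` (edition 1, the diagonal instance), `B9LeafXCodedKnitU` (§0 reindex lemmas, USED BY NAME),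
`Node00.CarriersYUParH` (the bundle, its `rfl` faces), `B9SectBCodedReadingsUParH` (`KSCUPar`, `SectBStepUPar`), `B9SectBStepUOfMembersR` (`thm32Printed_codedU`),
`B9SectBCodedChainR3` (`KACU_members_base`, the congruence lemmas), `B9SectBCodedCarrierPullbacks`, `B9LeafKnitOn`, `B9` — all USED BY NAME.
-/

noncomputable section

namespace Literature.MathematicalPhysics.QuantumFieldTheory.Balaban1983to89.B9LeafXCodedKnitUParH

open DagBinding (PrintedCarriers9X B9LeafX B6BlockParam)
open B9PinMembersKLevelV1 (MemberY geo9Y bg9Y)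
open B9BackgroundsKLevelV1R (RegFamY bg9YR kernelFamilyR kernelFamilyRY siteKernelR fineKernelR rwExpansionR rwKernelExpansionR hKernelR hKernelRY)
open B9PinGeometryKLevelV1 (dOmegaY OmKY inΛY unitDistY InCubeY c35Y c35Y_pos dictAtOneY not_inCubeY)
open B9PinCarriersKLevelV1 (OperatorLayerY)
open B9PinCarriersKLevelV1R (carriersYR)
open B9SectBCodedClassR (RegExtraY regC335 regC336 bg9YC)
open B9SectBCodedCarrier (Coding pullK pullS thm33Printed_coded)
open B9SectBCodedCarrierPullbacks (pullF pullH pullRW pullRWK pullC pullPK pullPH pullPK₀ thm31Printed_coded thm37Printed_coded cor38Printed_coded thm39Printed_coded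
  thm310Printed_coded thm311Printed_coded thm312Printed_coded thm313Printed_coded thm314Printed_coded thm314LocalPrinted_coded thm315FullPrinted_coded
  stmt349Printed_coded stmt3132Printed_coded)
open B9SectBGpFrameCodedYR (codingYx)
open B9SectBCodedReadingsUR (KSCU KACU SectBStepU)
open B9SectBCodedReadingsUParH (KSCUPar SectBStepUPar)
open B9SectBCodedChainAnR (IsAnKY)
open B9SectBKerFrameCodedYR (CinvY)
open B9SectBCodedClassGY (C37GY)
open B9SectBStepsKSCUR (KSCU_members_base KACU_members_base ineq342_346_347_congr thms_KSCU_base_iff)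
open B9SectBGpTransferInYR (ineq343_345_congr)
open B9SectBStepUOfMembersR (thm32Printed_codedU thm33Printed_codedU)
open B9LeafKnitOn (baseU1_of_b6BlockParam_on)
open B9Eq360DeltaPrimeAY (AfldY)
open B6Ineq2142KLevelV1 (β)
open Node00 (SiteY BlkY IBondY CfgY SiteParY BondParY BondOpY GAY GpY parSymY parBY kernelFamilyS kernelFamilyB carriersYU carriersYUPar carriersYUParH codingYU cqY)
open B9LeafXCodedKnitU (thm37Printed_reindex cor38Printed_reindex thm39Printed_reindex thm310Printed_reindex thm311Printed_reindex thm312Printed_reindex thm313Printed_reindex thm314Printed_reindex thm314LocalPrinted_reindex thm315FullPrinted_reindex stmt349Printed_reindex stmt3132Printed_reindex baseU1Printed_reindex thm31Printed_reindex thm32Printed_reindex thm33Printed_reindex thm31Printed_codedU baseU1Printed_codedU)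

variable {d ℓ : ℕ} {hd : 1 ≤ d + 1} {hL : Odd (ℓ + 1) ∧ 1 < ℓ + 1} {b₀ b₁ : ℝ} {Mstar : ℕ}
variable {𝔸 : Type} [NormedRing 𝔸] (P : RegExtraY d ℓ hd hL b₀ b₁ Mstar 𝔸) [NormedAlgebra ℂ 𝔸] [CompleteSpace 𝔸] (G : Subgroup 𝔸ˣ)
  {J : Type} (f : J → MemberY d ℓ hd hL b₀ b₁ Mstar)
  (C38 : ∀ j : J, ℝ → CfgY 𝔸 (f j).toKIdx → AfldY 𝔸 (f j).toKIdx → Prop)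

/-! ## §1 The U-letter coded reading with the two transporters at a base (`rfl`-level over dag-n06-c's `KSCUPar`) -/

section CodedUPar

variable (x : MemberY d ℓ hd hL b₀ b₁ Mstar) (parA parH : SiteParY 𝔸 x.toKIdx) (OA : BondOpY 𝔸 x.toKIdx) (parB : BondParY 𝔸 x.toKIdx)
  (C37 C38x : ℝ → CfgY 𝔸 x.toKIdx → AfldY 𝔸 x.toKIdx → Prop)

/-- the six members of `KSCUPar … parA parH` at `base U` are those of the record's G′ family `kernelFamilyS … (GpY parA) parH` read along the decoding (`rfl` ×6;
dag-n06-c's `KSCU_members_base` with the two transporters). [cite: Balaban1985BackgroundPropagators, (3.42)–(3.47) pp.397–398, (3.21) p.394, (3.40) p.397, bookkeeping] -/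
theorem KSCUPar_members_base (U : CfgY 𝔸 x.toKIdx) :
    (∀ n, (KSCUPar P G x parA parH C37 C38x).e n (.base U) =
      (pullK (codingYx P G x C37 C38x) (kernelFamilyS x.toKIdx (bg9YC 𝔸 G P x) (fun U => U) (GpY x.toKIdx parA) parH)).e n (.base U)) ∧
    (KSCUPar P G x parA parH C37 C38x).h1 (.base U) =
      (pullK (codingYx P G x C37 C38x) (kernelFamilyS x.toKIdx (bg9YC 𝔸 G P x) (fun U => U) (GpY x.toKIdx parA) parH)).h1 (.base U) ∧
    (KSCUPar P G x parA parH C37 C38x).e4 (.base U) =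
      (pullK (codingYx P G x C37 C38x) (kernelFamilyS x.toKIdx (bg9YC 𝔸 G P x) (fun U => U) (GpY x.toKIdx parA) parH)).e4 (.base U) ∧
    (KSCUPar P G x parA parH C37 C38x).h2 (.base U) =
      (pullK (codingYx P G x C37 C38x) (kernelFamilyS x.toKIdx (bg9YC 𝔸 G P x) (fun U => U) (GpY x.toKIdx parA) parH)).h2 (.base U) ∧
    (∀ n, (KSCUPar P G x parA parH C37 C38x).l2 n (.base U) =
      (pullK (codingYx P G x C37 C38x) (kernelFamilyS x.toKIdx (bg9YC 𝔸 G P x) (fun U => U) (GpY x.toKIdx parA) parH)).l2 n (.base U)) ∧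
    (∀ n, (KSCUPar P G x parA parH C37 C38x).glob n (.base U) =
      (pullK (codingYx P G x C37 C38x) (kernelFamilyS x.toKIdx (bg9YC 𝔸 G P x) (fun U => U) (GpY x.toKIdx parA) parH)).glob n (.base U)) :=
  ⟨fun _ => rfl, rfl, rfl, rfl, fun _ => rfl, fun _ => rfl⟩

/-- ★ the Theorem-3.1–3.3 block at a base transports between `(KSCUPar parA parH, KACU)` and the pulled-back record families (both directions; the (3.48) family is
shared) — dag-n06-c's `thms_KSCU_base_iff` with the two transporters. [cite: Balaban1985BackgroundPropagators, (3.42)–(3.48) pp.397–398, bookkeeping] -/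
theorem thms_KSCUPar_base_iff (dC : ℕ) (Cinv : B9.SiteKernel (geo9Y x) (bg9YC 𝔸 G P x)) (B₀ δ₀ : ℝ) (Bβ Bε : ℝ → ℝ) (Bεβ : ℝ → ℝ → ℝ) (B₁ δ₁ : ℝ)
    (U : CfgY 𝔸 x.toKIdx) :
    B9.Thms31to33IneqAt dC (KSCUPar P G x parA parH C37 C38x) (KACU P G x OA parB C37 C38x) (pullS (codingYx P G x C37 C38x) Cinv) B₀ δ₀ Bβ Bε Bεβ B₁ δ₁ (.base U) ↔
      B9.Thms31to33IneqAt dC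
        (pullK (codingYx P G x C37 C38x) (kernelFamilyS x.toKIdx (bg9YC 𝔸 G P x) (fun U => U) (GpY x.toKIdx parA) parH))
        (pullK (codingYx P G x C37 C38x) (kernelFamilyB x.toKIdx (bg9YC 𝔸 G P x) (fun U => U) OA parB))
        (pullS (codingYx P G x C37 C38x) Cinv) B₀ δ₀ Bβ Bε Bεβ B₁ δ₁ (.base U) := by
  obtain ⟨se, sh1, se4, sh2, sl2, sg⟩ := KSCUPar_members_base P G x parA parH C37 C38x U
  obtain ⟨ae, ah1, ae4, ah2, al2, ag⟩ := KACU_members_base P G x OA parB C37 C38x U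
  constructor
  · rintro ⟨⟨h42, h43⟩, hC, ⟨g42, g43⟩⟩
    exact ⟨⟨ineq342_346_347_congr P G x C37 C38x _ _ se sl2 sg B₀ δ₀ h42, ineq343_345_congr P G x C37 C38x _ _ sh1 se4 sh2 Bβ Bε Bεβ δ₀ h43⟩, hC,
      ⟨ineq342_346_347_congr P G x C37 C38x _ _ ae al2 ag B₀ δ₀ g42, ineq343_345_congr P G x C37 C38x _ _ ah1 ae4 ah2 Bβ Bε Bεβ δ₀ g43⟩⟩
  · rintro ⟨⟨h42, h43⟩, hC, ⟨g42, g43⟩⟩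
    exact ⟨⟨ineq342_346_347_congr P G x C37 C38x _ _ (fun n => (se n).symm) (fun n => (sl2 n).symm) (fun n => (sg n).symm) B₀ δ₀ h42,
        ineq343_345_congr P G x C37 C38x _ _ sh1.symm se4.symm sh2.symm Bβ Bε Bεβ δ₀ h43⟩, hC,
      ⟨ineq342_346_347_congr P G x C37 C38x _ _ (fun n => (ae n).symm) (fun n => (al2 n).symm) (fun n => (ag n).symm) B₀ δ₀ g42,
        ineq343_345_congr P G x C37 C38x _ _ ah1.symm ae4.symm ah2.symm Bβ Bε Bεβ δ₀ g43⟩⟩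

end CodedUPar

section CodedUParFamily

variable (parA parH : ∀ j : J, SiteParY 𝔸 (f j).toKIdx) (OA : ∀ j : J, BondOpY 𝔸 (f j).toKIdx) (parB : ∀ j : J, BondParY 𝔸 (f j).toKIdx) (c35 : ℝ)
  (C37 : ∀ j : J, ℝ → CfgY 𝔸 (f j).toKIdx → AfldY 𝔸 (f j).toKIdx → Prop)
  (Cinv : ∀ j : J, B9.SiteKernel (geo9Y (f j)) (bg9YC 𝔸 G P (f j)))

/-- ★ Theorem 3.1 of the record for `G′ = GpY parA` read by `kernelFamilyS … (GpY parA) parH` over the class-parametric carrier gives Theorem 3.1 over the coded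
carriers for `KSCUPar parA parH` (edition 1's `thm31Printed_codedU` with the two transporters; `KSCUPar_members_base`, `rfl`).
[cite: Balaban1985BackgroundPropagators, Thm 3.1 (3.42)–(3.47) pp.397–398, Thm 3.4 p.400, (3.35) p.396, (3.21) p.394, (3.40) p.397] -/
theorem thm31Printed_codedUPar
    (h31 : B9.Thm31Printed c35 (fun j => geo9Y (f j)) (fun j => bg9YC 𝔸 G P (f j))
      (fun j => kernelFamilyS (f j).toKIdx (bg9YC 𝔸 G P (f j)) (fun U => U) (GpY (f j).toKIdx (parA j)) (parH j))) :
    B9.Thm31Printed c35 (fun j => geo9Y (f j)) (fun j => (codingYx P G (f j) (C37 j) (C38 j)).bg) (fun j => KSCUPar P G (f j) (parA j) (parH j) (C37 j) (C38 j)) := by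
  obtain ⟨M₁, δ₀, a₀, B₀, Bβ, Bε, Bεβ, hM₁, hδ₀, ha₀, hB₀, H⟩ :=
    thm31Printed_coded c35 (fun j => geo9Y (f j)) (fun j => bg9YC 𝔸 G P (f j)) (fun j => codingYx P G (f j) (C37 j) (C38 j)) _ h31
  refine ⟨M₁, δ₀, a₀, B₀, Bβ, Bε, Bεβ, hM₁, hδ₀, ha₀, hB₀, fun j hM α₀ hα₀ hMα c hc => ?_⟩
  obtain ⟨U, rfl, -⟩ := (codingYx P G (f j) (C37 j) (C38 j)).exists_of_bg_Reg335 hc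
  obtain ⟨h42, h43⟩ := H j hM α₀ hα₀ hMα _ hc
  obtain ⟨se, sh1, se4, sh2, sl2, sg⟩ := KSCUPar_members_base P G (f j) (parA j) (parH j) (C37 j) (C38 j) U
  exact ⟨ineq342_346_347_congr P G (f j) (C37 j) (C38 j) _ _ (fun n => (se n).symm) (fun n => (sl2 n).symm) (fun n => (sg n).symm) B₀ δ₀ h42,
    ineq343_345_congr P G (f j) (C37 j) (C38 j) _ _ sh1.symm se4.symm sh2.symm Bβ Bε Bεβ δ₀ h43⟩

/-- ★ the `U ≡ 1` block of the record (`B9.BaseU1Printed` for `kernelFamilyS … (GpY parA) parH`, `kernelFamilyB … OA parB`, `C⁻¹`) gives the block over the coded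
carriers for `(KSCUPar parA parH, KACU, C⁻¹ ∘ dec)` at `one = base 1` (`thms_KSCUPar_base_iff`; edition 1's `baseU1Printed_codedU` with the two transporters).
[cite: Balaban1985BackgroundPropagators, Cor. 3.5 proof p.407 («for U = 1 these theorems are proved in [4]»), Thm 3.4 p.400] -/
theorem baseU1Printed_codedUPar (dC : ℕ)
    (h : B9.BaseU1Printed dC (fun j => geo9Y (f j)) (fun j => bg9YC 𝔸 G P (f j))
      (fun j => kernelFamilyS (f j).toKIdx (bg9YC 𝔸 G P (f j)) (fun U => U) (GpY (f j).toKIdx (parA j)) (parH j))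
      (fun j => kernelFamilyB (f j).toKIdx (bg9YC 𝔸 G P (f j)) (fun U => U) (OA j) (parB j)) Cinv) :
    B9.BaseU1Printed dC (fun j => geo9Y (f j)) (fun j => (codingYx P G (f j) (C37 j) (C38 j)).bg) (fun j => KSCUPar P G (f j) (parA j) (parH j) (C37 j) (C38 j))
      (fun j => KACU P G (f j) (OA j) (parB j) (C37 j) (C38 j)) (fun j => pullS (codingYx P G (f j) (C37 j) (C38 j)) (Cinv j)) := by
  obtain ⟨M₁, B₀, δ₀, Bβ, Bε, Bεβ, B₁, δ₁, hM₁, hB₀, hδ₀, hB₁, hδ₁, H⟩ := h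
  exact ⟨M₁, B₀, δ₀, Bβ, Bε, Bεβ, B₁, δ₁, hM₁, hB₀, hδ₀, hB₁, hδ₁, fun j hM =>
    (thms_KSCUPar_base_iff P G (f j) (parA j) (parH j) (OA j) (parB j) (C37 j) (C38 j) dC (Cinv j) B₀ δ₀ Bβ Bε Bεβ B₁ δ₁ _).2 (H j hM)⟩

/-- ★ Theorem 3.3 of the record for `(G′, G)` read by `kernelFamilyS … (GpY parA) parH ∕ kernelFamilyB … OA parB` gives Theorem 3.3 over the coded carriers for
`(KSCUPar parA parH, KACU)` (dag-n06-c's `thm33Printed_codedU` with the two transporters; `KSCUPar_members_base ∕ KACU_members_base`, `rfl`).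
[cite: Balaban1985BackgroundPropagators, Thm 3.3 p.399, Thm 3.1 (3.42)–(3.47) pp.397–398, (3.35) p.396, (3.21) p.394, (3.40) p.397] -/
theorem thm33Printed_codedUPar
    (h33 : B9.Thm33Printed c35 (fun j => geo9Y (f j)) (fun j => bg9YC 𝔸 G P (f j))
      (fun j => kernelFamilyS (f j).toKIdx (bg9YC 𝔸 G P (f j)) (fun U => U) (GpY (f j).toKIdx (parA j)) (parH j))
      (fun j => kernelFamilyB (f j).toKIdx (bg9YC 𝔸 G P (f j)) (fun U => U) (OA j) (parB j))) :
    B9.Thm33Printed c35 (fun j => geo9Y (f j)) (fun j => (codingYx P G (f j) (C37 j) (C38 j)).bg) (fun j => KSCUPar P G (f j) (parA j) (parH j) (C37 j) (C38 j))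
      (fun j => KACU P G (f j) (OA j) (parB j) (C37 j) (C38 j)) := by
  obtain ⟨M₁, δ₀, a₀, B₀, Bβ, Bε, Bεβ, hM₁, hδ₀, ha₀, hB₀, H⟩ :=
    thm33Printed_coded c35 (fun j => geo9Y (f j)) (fun j => bg9YC 𝔸 G P (f j)) (fun j => codingYx P G (f j) (C37 j) (C38 j)) _ _ h33
  refine ⟨M₁, δ₀, a₀, B₀, Bβ, Bε, Bεβ, hM₁, hδ₀, ha₀, hB₀, fun j hM α₀ hα₀ hMα c hc => ?_⟩
  obtain ⟨U, rfl, -⟩ := (codingYx P G (f j) (C37 j) (C38 j)).exists_of_bg_Reg335 hc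
  obtain ⟨⟨h42, h43⟩, ⟨g42, g43⟩⟩ := H j hM α₀ hα₀ hMα _ hc
  obtain ⟨se, sh1, se4, sh2, sl2, sg⟩ := KSCUPar_members_base P G (f j) (parA j) (parH j) (C37 j) (C38 j) U
  obtain ⟨ae, ah1, ae4, ah2, al2, ag⟩ := KACU_members_base P G (f j) (OA j) (parB j) (C37 j) (C38 j) U
  exact ⟨⟨ineq342_346_347_congr P G (f j) (C37 j) (C38 j) _ _ (fun n => (se n).symm) (fun n => (sl2 n).symm) (fun n => (sg n).symm) B₀ δ₀ h42,
      ineq343_345_congr P G (f j) (C37 j) (C38 j) _ _ sh1.symm se4.symm sh2.symm Bβ Bε Bεβ δ₀ h43⟩,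
    ⟨ineq342_346_347_congr P G (f j) (C37 j) (C38 j) _ _ (fun n => (ae n).symm) (fun n => (al2 n).symm) (fun n => (ag n).symm) B₀ δ₀ g42,
      ineq343_345_congr P G (f j) (C37 j) (C38 j) _ _ ah1.symm ae4.symm ah2.symm Bβ Bε Bεβ δ₀ g43⟩⟩

end CodedUParFamily

/-! ## §2 ★★★ The leaf over the coded carrier with the two transporters -/

section Knit

variable {ι : Type} [Fintype ι] (b : Module.Basis ι ℝ 𝔸) (ιB : ∀ j : J, BlkY (f j).toKIdx → IBondY (f j).toKIdx)
  (parA parH : ∀ j : J, SiteParY 𝔸 (f j).toKIdx) (OA : ∀ j : J, BondOpY 𝔸 (f j).toKIdx)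
  (ops : ∀ x : MemberY d ℓ hd hL b₀ b₁ Mstar, OperatorLayerY d ℓ hd hL b₀ b₁ Mstar 𝔸 G x)

/-- ★★★ **`B9LeafX (carriersYUParH P G f b ιB C38 parA parH OA ops)` — THE [B9] LEAF OVER THE CODED CARRIER WITH THE AVERAGING TRANSPORTER `parA`, THE
HÖLDER TRANSPORTER `parH` AND THE BOND-AVERAGE LETTER `OA`** (CASCADE-K, director-ym №383; leaf edition 2): `b9LeafX_carriersYUPar` with its three pins and the
coded Sect.-B step read at `(parA, parH, OA)` — `hGpPin : … = kernelFamilyS … (GpY _ (parA j)) (parH j)`, `hCinvPin : … = CinvY P f G parA j`,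
`hB : … → SectBStepUPar P f (d+1) c35Y G b parA parH OA …`; `hone`, the `U = 1` comparisons, the null readings, the residual entries, the rows 15–26 at
`(regC335 P, regC336 P)` and the [B6] block VERBATIM; proof verbatim through §1.  Instances: `parA = parH` = edition 1 (`carriersYUPar_eq_carriersYUParH`, `rfl`);
`(parKnitY, parSymY, GAQY (qKnitOfRecord …) …)` = the knit certificate's leaf (def-Y's pins `opsYNuStOfRecordV11KHE_GpPin ∕ _GAPin ∕ _CinvPin`).
[cite: Balaban1985BackgroundPropagators, Thms 3.1–3.15 pp.397–432, Thm 3.4 p.400, Cor. 3.5 proof p.407, p.410, (3.19) p.393, (3.21) p.394, (3.40) p.397; Balaban1985Averaging, Prop. 2 p.26; Balaban1984PropagatorsII, Props. 2.2, 2.3, 2.6] -/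
theorem b9LeafX_carriersYUParH (δ₀ : ℝ) {Jt Kt : Type} (tree : Jt → B6.TreeData) (loc : Kt → B6.LocalOp)
    (hone : ∀ (j : J) (α₀ : ℝ), 0 < α₀ → regC335 𝔸 G P (f j) c35Y α₀ (bg9YC 𝔸 G P (f j)).one)
    (hGp_e : ∀ (x : MemberY d ℓ hd hL b₀ b₁ Mstar) (n : Fin 4) (lam : (geo9Y x).Loc) (y : (geo9Y x).Site),
      (ops x).Gp.e n (bg9Y 𝔸 G x).one lam y ≤ (Node00.GpU x.toKIdx).e n lam y)
    (hGp_h1 : ∀ (x : MemberY d ℓ hd hL b₀ b₁ Mstar) (lam : (geo9Y x).Loc) (b : ℝ) (ζ : (geo9Y x).Cut),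
      (ops x).Gp.h1 (bg9Y 𝔸 G x).one lam b ζ ≤ (Node00.GpU x.toKIdx).h1 lam b ζ)
    (hC : ∀ (x : MemberY d ℓ hd hL b₀ b₁ Mstar) (y y' : (geo9Y x).Site), |(ops x).Cinv.ker (bg9Y 𝔸 G x).one y y'| ≤ |(Node00.CinvU x.toKIdx).ker y y'|)
    (hGA_e : ∀ (x : MemberY d ℓ hd hL b₀ b₁ Mstar) (n : Fin 4) (lam : (geo9Y x).Loc) (y : (geo9Y x).Site),
      (ops x).GA.e n (bg9Y 𝔸 G x).one lam y ≤ (Node00.GU x.toKIdx).e n lam y)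
    (hGA_h1 : ∀ (x : MemberY d ℓ hd hL b₀ b₁ Mstar) (lam : (geo9Y x).Loc) (b : ℝ) (ζ : (geo9Y x).Cut),
      (ops x).GA.h1 (bg9Y 𝔸 G x).one lam b ζ ≤ (Node00.GU x.toKIdx).h1 lam b ζ)
    (hGA_e4 : ∀ (x : MemberY d ℓ hd hL b₀ b₁ Mstar) (lam : (geo9Y x).Loc) (y : (geo9Y x).Site),
      (ops x).GA.e4 (bg9Y 𝔸 G x).one lam y ≤ (Node00.GU x.toKIdx).e4 lam y)
    (hGA_h2 : ∀ (x : MemberY d ℓ hd hL b₀ b₁ Mstar) (lam : (geo9Y x).Loc) (b : ℝ) (ζ : (geo9Y x).Cut),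
      (ops x).GA.h2 (bg9Y 𝔸 G x).one lam b ζ ≤ (Node00.GU x.toKIdx).h2 lam b ζ)
    (hGA_l2 : ∀ (x : MemberY d ℓ hd hL b₀ b₁ Mstar) (n : Fin 6) (lam : (geo9Y x).Loc) (h : (geo9Y x).Cut),
      (ops x).GA.l2 n (bg9Y 𝔸 G x).one lam h ≤ (Node00.GU x.toKIdx).l2 n lam h)
    (hE4 : ∀ (x : MemberY d ℓ hd hL b₀ b₁ Mstar) (lam : (geo9Y x).Loc), ¬ (lam.isRight = true) → ∀ y, (ops x).GA.e4 (bg9Y 𝔸 G x).one lam y ≤ 0)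
    (hH2 : ∀ (x : MemberY d ℓ hd hL b₀ b₁ Mstar) (lam : (geo9Y x).Loc), ¬ (lam.isRight = true) →
      ∀ (β : ℝ) (ζ : (geo9Y x).Cut), (ops x).GA.h2 (bg9Y 𝔸 G x).one lam β ζ ≤ 0)
    (hGp : B9FromB6.ResidualGpAtOne geo9Y (bg9YR 𝔸 G (regC335 𝔸 G P) (regC336 𝔸 G P)) (fun x => kernelFamilyR (regC335 𝔸 G P) (regC336 𝔸 G P) (ops x).Gp))
    (hGA : B9FromB6.ResidualGAGlobAtOne geo9Y (bg9YR 𝔸 G (regC335 𝔸 G P) (regC336 𝔸 G P)) (fun x => kernelFamilyR (regC335 𝔸 G P) (regC336 𝔸 G P) (ops x).GA))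
    (hGpPin : ∀ j : J, kernelFamilyR (regC335 𝔸 G P) (regC336 𝔸 G P) (ops (f j)).Gp =
      kernelFamilyS (f j).toKIdx (bg9YC 𝔸 G P (f j)) (fun U => U) (GpY (f j).toKIdx (parA j)) (parH j))
    (hGAPin : ∀ j : J, kernelFamilyR (regC335 𝔸 G P) (regC336 𝔸 G P) (ops (f j)).GA =
      kernelFamilyB (f j).toKIdx (bg9YC 𝔸 G P (f j)) (fun U => U)
        (OA j) (parBY (f j).toKIdx))
    (hCinvPin : ∀ j : J, siteKernelR (regC335 𝔸 G P) (regC336 𝔸 G P) (ops (f j)).Cinv = CinvY P f G parA j)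
    (hB : B9.Thm32Printed (d + 1) c35Y (fun j => geo9Y (f j)) (fun j => bg9YC 𝔸 G P (f j)) (CinvY P f G parA) →
      B9.Thm33Printed c35Y (fun j => geo9Y (f j)) (fun j => bg9YC 𝔸 G P (f j))
        (fun j => kernelFamilyS (f j).toKIdx (bg9YC 𝔸 G P (f j)) (fun U => U) (GpY (f j).toKIdx (parA j)) (parH j))
        (fun j => kernelFamilyB (f j).toKIdx (bg9YC 𝔸 G P (f j)) (fun U => U)
          (OA j) (parBY (f j).toKIdx)) →
      SectBStepUPar P f (d + 1) c35Y G b parA parH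
        OA (fun j => parBY (f j).toKIdx)
        (fun j => C37GY G (f j) (ιB j) (cqY d)) C38 (CinvY P f G parA))
    (t37 : B9.Thm37Printed c35Y geo9Y (bg9YR 𝔸 G (regC335 𝔸 G P) (regC336 𝔸 G P)) (fun x => rwExpansionR (regC335 𝔸 G P) (regC336 𝔸 G P) (ops x).E37))
    (c38 : B9.Cor38Printed c35Y geo9Y (bg9YR 𝔸 G (regC335 𝔸 G P) (regC336 𝔸 G P)) (fun x => rwExpansionR (regC335 𝔸 G P) (regC336 𝔸 G P) (ops x).E37))
    (t39 : B9.Thm39Printed (d + 1) c35Y geo9Y (bg9YR 𝔸 G (regC335 𝔸 G P) (regC336 𝔸 G P))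
      (fun x => rwKernelExpansionR (regC335 𝔸 G P) (regC336 𝔸 G P) (ops x).EK39))
    (t310 : B9.Thm310Printed c35Y geo9Y (bg9YR 𝔸 G (regC335 𝔸 G P) (regC336 𝔸 G P)) (fun x => rwExpansionR (regC335 𝔸 G P) (regC336 𝔸 G P) (ops x).E310))
    (hsum : B9.RWSumsYieldIneqs geo9Y (bg9YR 𝔸 G (regC335 𝔸 G P) (regC336 𝔸 G P)) (fun x => rwExpansionR (regC335 𝔸 G P) (regC336 𝔸 G P) (ops x).E37)
      (fun x => rwExpansionR (regC335 𝔸 G P) (regC336 𝔸 G P) (ops x).E310) (fun x => kernelFamilyR (regC335 𝔸 G P) (regC336 𝔸 G P) (ops x).Gp)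
      (fun x => kernelFamilyR (regC335 𝔸 G P) (regC336 𝔸 G P) (ops x).GA))
    (hksum : B9.RWKernelSumYields (d + 1) geo9Y (bg9YR 𝔸 G (regC335 𝔸 G P) (regC336 𝔸 G P))
      (fun x => rwKernelExpansionR (regC335 𝔸 G P) (regC336 𝔸 G P) (ops x).EK39) (fun x => siteKernelR (regC335 𝔸 G P) (regC336 𝔸 G P) (ops x).Cinv))
    (t311 : B9.Thm311Printed c35Y geo9Y (bg9YR 𝔸 G (regC335 𝔸 G P) (regC336 𝔸 G P)) (fun x => (ops x).PosDef))
    (t312 : B9.Thm312Printed (d + 1) c35Y geo9Y (bg9YR 𝔸 G (regC335 𝔸 G P) (regC336 𝔸 G P))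
      (fun x => kernelFamilyR (regC335 𝔸 G P) (regC336 𝔸 G P) (ops x).GD) (fun x => kernelFamilyR (regC335 𝔸 G P) (regC336 𝔸 G P) (ops x).G₁)
      (fun x => hKernelR (regC335 𝔸 G P) (regC336 𝔸 G P) (ops x).H) (fun x => hKernelR (regC335 𝔸 G P) (regC336 𝔸 G P) (ops x).H₁)
      (fun x K => (ops x).HasRWExp (kernelFamilyRY K)) (fun x K => (ops x).HasRWExpH (hKernelRY K)) (fun x K => (ops x).PosDefK (kernelFamilyRY K)))
    (t313 : B9.Thm313Printed c35Y geo9Y (bg9YR 𝔸 G (regC335 𝔸 G P) (regC336 𝔸 G P)) (fun x => kernelFamilyR (regC335 𝔸 G P) (regC336 𝔸 G P) (ops x).GG)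
      (fun x K => (ops x).HasRWExp (kernelFamilyRY K)) (fun x K => (ops x).PosDefK (kernelFamilyRY K)))
    (t314 : B9.Thm314Printed c35Y geo9Y (bg9YR 𝔸 G (regC335 𝔸 G P) (regC336 𝔸 G P)) (fun x => kernelFamilyR (regC335 𝔸 G P) (regC336 𝔸 G P) (ops x).Kdiff)
      dOmegaY)
    (t315 : B9.Thm315FullPrinted c35Y geo9Y (bg9YR 𝔸 G (regC335 𝔸 G P) (regC336 𝔸 G P)) (fun x => siteKernelR (regC335 𝔸 G P) (regC336 𝔸 G P) (ops x).Ck)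
      inΛY unitDistY (fun x => (ops x).GivenBy3185) (fun x => (ops x).HasRWExpC))
    (s349 : B9.Stmt349Printed (d + 1) c35Y geo9Y (bg9YR 𝔸 G (regC335 𝔸 G P) (regC336 𝔸 G P))
      (fun x => fineKernelR (regC335 𝔸 G P) (regC336 𝔸 G P) (ops x).P349))
    (s3132 : B9.Stmt3132Printed (d + 1) c35Y geo9Y (bg9YR 𝔸 G (regC335 𝔸 G P) (regC336 𝔸 G P))
      (fun x => siteKernelR (regC335 𝔸 G P) (regC336 𝔸 G P) (ops x).QGQinv) (fun x => siteKernelR (regC335 𝔸 G P) (regC336 𝔸 G P) (ops x).QG1Qinv))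
    (t314loc : B9Thm314.Thm314LocalPrinted c35Y geo9Y (bg9YR 𝔸 G (regC335 𝔸 G P) (regC336 𝔸 G P))
      (fun x => kernelFamilyR (regC335 𝔸 G P) (regC336 𝔸 G P) (ops x).Kdiff) OmKY dOmegaY)
    (h6 : B6BlockParam (Node00.towerBlockOfRecord d ℓ hd hL b₀ b₁ δ₀ tree loc)) :
    B9LeafX (carriersYUParH P G f b ιB C38 parA parH OA ops) := by
  -- (1) at the record, over the full member family at the classes `(regC335 P, regC336 P)`: the `U ≡ 1` block from [B6], Thms 3.1 ∕ 3.2 ∕ 3.3 from rows 15–19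
  have hbaseR : B9.BaseU1Printed (d + 1) geo9Y (bg9YR 𝔸 G (regC335 𝔸 G P) (regC336 𝔸 G P))
      (fun x => kernelFamilyR (regC335 𝔸 G P) (regC336 𝔸 G P) (ops x).Gp) (fun x => kernelFamilyR (regC335 𝔸 G P) (regC336 𝔸 G P) (ops x).GA)
      (fun x => siteKernelR (regC335 𝔸 G P) (regC336 𝔸 G P) (ops x).Cinv) :=
    baseU1_of_b6BlockParam_on (carriersYR d ℓ hd hL b₀ b₁ Mstar 𝔸 G (regC335 𝔸 G P) (regC336 𝔸 G P) ops).toPrintedCarriers9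
      (Node00.towerBlockOfRecord d ℓ hd hL b₀ b₁ δ₀ tree loc) rfl (fun x => ⟨x.toKIdx, x.hcfk⟩)
      (fun x => dictAtOneY x (kernelFamilyR (regC335 𝔸 G P) (regC336 𝔸 G P) (ops x).Gp) (kernelFamilyR (regC335 𝔸 G P) (regC336 𝔸 G P) (ops x).GA)
        (siteKernelR (regC335 𝔸 G P) (regC336 𝔸 G P) (ops x).Cinv) (hGp_e x) (hGp_h1 x) (hC x) (hGA_e x) (hGA_h1 x) (hGA_e4 x) (hGA_h2 x) (hGA_l2 x))
      (fun _ => fun lam => lam.isRight = true) (fun x => B9GeoNormsKLevelModelSignsV1.modelSignsOn_geo9K x.toKIdx) hE4 hH2 hGp hGA h6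
  have h31R := B9.thm31_of_thm37 c35Y geo9Y (bg9YR 𝔸 G (regC335 𝔸 G P) (regC336 𝔸 G P)) _ _ _ _ t37 hsum
  have h32R := B9.thm32_of_thm39 (d + 1) c35Y geo9Y (bg9YR 𝔸 G (regC335 𝔸 G P) (regC336 𝔸 G P)) _ _ t39 hksum
  have h33R := B9.thm33_of_thm37_310 c35Y geo9Y (bg9YR 𝔸 G (regC335 𝔸 G P) (regC336 𝔸 G P)) _ _ _ _ t37 t310 hsum
  -- (2) along the subfamily, re-keyed to NODE 00's letter readings by the pins
  have eGp := funext hGpPin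
  have eGA := funext hGAPin
  have eC := funext hCinvPin
  have hbaseJ := baseU1Printed_reindex f (d + 1) geo9Y (bg9YR 𝔸 G (regC335 𝔸 G P) (regC336 𝔸 G P)) _ _ _ hbaseR
  have h31J := thm31Printed_reindex f c35Y geo9Y (bg9YR 𝔸 G (regC335 𝔸 G P) (regC336 𝔸 G P)) _ h31R
  have h32J := thm32Printed_reindex f (d + 1) c35Y geo9Y (bg9YR 𝔸 G (regC335 𝔸 G P) (regC336 𝔸 G P)) _ h32R
  have h33J := thm33Printed_reindex f c35Y geo9Y (bg9YR 𝔸 G (regC335 𝔸 G P) (regC336 𝔸 G P)) _ _ h33R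
  rw [eGp, eGA, eC] at hbaseJ
  rw [eGp] at h31J
  rw [eC] at h32J
  rw [eGp, eGA] at h33J
  have h32J' : B9.Thm32Printed (d + 1) c35Y (fun j => geo9Y (f j)) (fun j => bg9YC 𝔸 G P (f j)) (CinvY P f G parA) := h32J
  have h33J' : B9.Thm33Printed c35Y (fun j => geo9Y (f j)) (fun j => bg9YC 𝔸 G P (f j))
      (fun j => kernelFamilyS (f j).toKIdx (bg9YC 𝔸 G P (f j)) (fun U => U) (GpY (f j).toKIdx (parA j)) (parH j))
      (fun j => kernelFamilyB (f j).toKIdx (bg9YC 𝔸 G P (f j)) (fun U => U)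
        (OA j) (parBY (f j).toKIdx)) := h33J
  have hBU := hB h32J' h33J'
  -- (3) over the coded carrier
  have hbaseU := baseU1Printed_codedUPar P G f C38 parA parH
    OA (fun j => parBY (f j).toKIdx)
    (fun j => C37GY G (f j) (ιB j) (cqY d)) (CinvY P f G parA) (d + 1) hbaseJ
  have h31U := thm31Printed_codedUPar P G f C38 parA parH c35Y (fun j => C37GY G (f j) (ιB j) (cqY d)) h31J
  have h32U := thm32Printed_codedU P f c35Y G C38 (C37 := fun j => C37GY G (f j) (ιB j) (cqY d))
    (Cinv := CinvY P f G parA) (d + 1) h32J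
  have h33U := thm33Printed_codedUPar P G f C38 parA parH
    OA (fun j => parBY (f j).toKIdx) c35Y
    (fun j => C37GY G (f j) (ιB j) (cqY d)) h33J
  have honeU : ∀ (j : J) (α₀ : ℝ), 0 < α₀ → ((carriersYUParH P G f b ιB C38 parA parH OA ops).bg9 j).Reg335 c35Y α₀ ((carriersYUParH P G f b ιB C38 parA parH OA ops).bg9 j).one :=
    fun j α₀ hα => hone j α₀ hα
  have h35 := B9.cor35_of_sectB_base (d + 1) c35Y (carriersYUParH P G f b ιB C38 parA parH OA ops).geo9 (carriersYUParH P G f b ιB C38 parA parH OA ops).bg9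
    (carriersYUParH P G f b ιB C38 parA parH OA ops).Gp (carriersYUParH P G f b ιB C38 parA parH OA ops).GA (carriersYUParH P G f b ιB C38 parA parH OA ops).Cinv (carriersYUParH P G f b ιB C38 parA parH OA ops).IsAnalyticExt
    honeU hbaseU hBU
  have hg : B9.GaugeReduction335 (d + 1) c35Y (carriersYUParH P G f b ιB C38 parA parH OA ops).geo9 (carriersYUParH P G f b ιB C38 parA parH OA ops).bg9 (carriersYUParH P G f b ιB C38 parA parH OA ops).InCube
      (carriersYUParH P G f b ιB C38 parA parH OA ops).Gp (carriersYUParH P G f b ιB C38 parA parH OA ops).GA (carriersYUParH P G f b ιB C38 parA parH OA ops).Cinv :=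
    fun j hj => absurd hj (not_inCubeY (f j))
  have h36 := B9.cor36_of_cor35 (d + 1) c35Y c35Y_pos _ _ _ _ _ _ h35 hg
  have h34 := B9.thm34_of_sectB (d + 1) c35Y (carriersYUParH P G f b ιB C38 parA parH OA ops).geo9 (carriersYUParH P G f b ιB C38 parA parH OA ops).bg9
    (carriersYUParH P G f b ιB C38 parA parH OA ops).Gp (carriersYUParH P G f b ιB C38 parA parH OA ops).GA (carriersYUParH P G f b ιB C38 parA parH OA ops).Cinv (carriersYUParH P G f b ιB C38 parA parH OA ops).IsAnalyticExt
    hBU h32U h33U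
  exact ⟨⟨h35, h36, h31U, h32U, h33U, h34,
      thm37Printed_coded c35Y _ _ (fun j => codingYU P G f ιB C38 j) _ (thm37Printed_reindex f c35Y geo9Y _ _ t37),
      cor38Printed_coded c35Y _ _ (fun j => codingYU P G f ιB C38 j) _ (cor38Printed_reindex f c35Y geo9Y _ _ c38),
      thm39Printed_coded (d + 1) c35Y _ _ (fun j => codingYU P G f ιB C38 j) _ (thm39Printed_reindex f (d + 1) c35Y geo9Y _ _ t39),
      thm310Printed_coded c35Y _ _ (fun j => codingYU P G f ιB C38 j) _ (thm310Printed_reindex f c35Y geo9Y _ _ t310),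
      thm311Printed_coded c35Y _ _ (fun j => codingYU P G f ιB C38 j) _ (thm311Printed_reindex f c35Y geo9Y _ _ t311),
      thm312Printed_coded (d + 1) c35Y _ _ (fun j => codingYU P G f ιB C38 j) _ _ _ _ _ _ _ (thm312Printed_reindex f (d + 1) c35Y geo9Y _ _ _ _ _ _ _ _ t312),
      thm313Printed_coded c35Y _ _ (fun j => codingYU P G f ιB C38 j) _ _ _ (thm313Printed_reindex f c35Y geo9Y _ _ _ _ t313),
      thm314Printed_coded c35Y _ _ (fun j => codingYU P G f ιB C38 j) _ _ (thm314Printed_reindex f c35Y geo9Y _ _ _ t314),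
      thm315FullPrinted_coded c35Y _ _ (fun j => codingYU P G f ιB C38 j) _ _ _ _ _ (thm315FullPrinted_reindex f c35Y geo9Y _ _ _ _ _ _ t315)⟩,
    stmt349Printed_coded (d + 1) c35Y _ _ (fun j => codingYU P G f ιB C38 j) _ (stmt349Printed_reindex f (d + 1) c35Y geo9Y _ _ s349),
    stmt3132Printed_coded (d + 1) c35Y _ _ (fun j => codingYU P G f ιB C38 j) _ _ (stmt3132Printed_reindex f (d + 1) c35Y geo9Y _ _ _ s3132),
    thm314LocalPrinted_coded c35Y _ _ (fun j => codingYU P G f ιB C38 j) _ _ _ (thm314LocalPrinted_reindex f c35Y geo9Y _ _ _ _ t314loc)⟩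

end Knit

end Literature.MathematicalPhysics.QuantumFieldTheory.Balaban1983to89.B9LeafXCodedKnitUParH

end
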